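import Mathlib
import HarnessLib
import Summits.ValiantsHypothesis.ValiantsHypothesis.Theorems.LacunarySymmetroidMatrixDescartesProductPlusOneEulerSectors

/-!
# ValiantsHypothesis / LacunarySymmetroid — crux `MatrixDescartes` (stmt-ValiantsHypothesis-18050, V1),
# LINE (A) «product_plus_one», stub S4″ `stub_eulerBoundK3`: the c-free Euler bound at the TOP coupling (reversal `x ↦ 1/x`)

Companion of `…ProductPlusOneEulerSectors` (✓ p657168: generic count `euler_pos_roots_le`, `eulerNumerator_eq`, the sharp sector at every
coupling, the tame and mixed sectors at the BOTTOM coupling).  Here: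

* `eval_eulerNumerator`, `eulerNumerator_reindex` (letter re-indexing by a permutation of `Fin K` leaves the Euler numerator unchanged),
  `eval_eulerNumerator_reverse` (general `K`, any coupled letter: `E_{D−d}(t) = −t^{mD}·E_d(1/t)`), `card_pos_roots_euler_le_reverse`
  (`Z₊(E_d) ≤ Z₊(E_{D−d})`, by `t ↦ 1/t` — p7 g14's `card_pos_roots_class_reverse` pattern for the Euler numerator);
* `eulerNumerator_reverse_top` (`K = 3`: the reversed numerator at `l₀ = 2` is the numerator of the data `(0, d 2 − d 1, d 2 − d 0)`,
  `(a_{j2}, a_{j1}, a_{j0})` at `l₀ = 0`);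
* ★ `eulerBound_tameTop`: no-dip factors, ratio `d 2 − d 0 ≤ 4 (d 2 − d 1)`, TOP coupling `l₀ = 2` ⇒ `Z₊(eulerNumerator d a 2) ≤ 2m + 2`;
* ★ `eulerBound_mixedTop`: no-dip or sharp-dip factors, `2 (d 2 − d 1) ≤ d 2 − d 0 ≤ 4 (d 2 − d 1)`, `l₀ = 2` ⇒ `Z₊(eulerNumerator d a 2) ≤ 4m + 1`.

With ✓ p657168 the kernel now covers, for the c-free Euler numerator of the `K = 3` row: sharp members at every coupling; tame and mixed
members at both EXTREME couplings (each under its chart's ratio window).  NOT covered: the MIDDLE coupling for non-sharp members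
(`…ProductPlusOneMiddleLaurent`), ratio outside the windows, zero-free factors — `stub_eulerBoundK3` stays OPEN.  Honest framing: sector rungs;
NOT `stub_eulerBoundK3` / `stub_classRowK3` / `MatrixDescartes` / B; `VP ≠ VNP` NOT proved.  No definitions, no named facts.
-/

set_option linter.dupNamespace false

namespace Summit.ValiantsHypothesis.ValiantsHypothesis.Theorems.LacunarySymmetroidMatrixDescartes

namespace ProductPlusOne

open Polynomial Finset
open scoped BigOperators

/-! ### §1 Symmetries of the Euler numerator: letter re-indexing and the reversal `x ↦ 1/x` -/

/-- Evaluation of the (unfolded) Euler numerator. [folklore] -/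
theorem eval_eulerNumerator {m K : ℕ} (d : Fin K → ℕ) (a : Fin m → Fin K → ℝ) (l₀ : Fin K) (t : ℝ) :
    eval t (∑ j, (∑ l, C (a j l * ((d l : ℝ) - d l₀)) * X ^ (d l)) * ∏ i ∈ Finset.univ.erase j, (∑ l, C (a i l) * X ^ (d l)) : ℝ[X])
      = ∑ j, (∑ l, a j l * ((d l : ℝ) - d l₀) * t ^ (d l)) * ∏ i ∈ Finset.univ.erase j, (∑ l, a i l * t ^ (d l)) := by
  simp only [eval_finsetSum, eval_mul, eval_prod, eval_C, eval_pow, eval_X]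

/-- **Letter re-indexing invariance**: permuting the letters (`d ∘ σ`, `a j ∘ σ`, `σ⁻¹ l₀`) does not change the Euler numerator. [folklore] -/
theorem eulerNumerator_reindex {m K : ℕ} (σ : Equiv.Perm (Fin K)) (d : Fin K → ℕ) (a : Fin m → Fin K → ℝ) (l₀ : Fin K) :
    (∑ j, (∑ l, C (a j (σ l) * (((d (σ l) : ℕ) : ℝ) - d (σ (σ.symm l₀)))) * X ^ (d (σ l)))
        * ∏ i ∈ Finset.univ.erase j, (∑ l, C (a i (σ l)) * X ^ (d (σ l))) : ℝ[X])
      = ∑ j, (∑ l, C (a j l * ((d l : ℝ) - d l₀)) * X ^ (d l)) * ∏ i ∈ Finset.univ.erase j, (∑ l, C (a i l) * X ^ (d l)) := by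
  rw [Equiv.apply_symm_apply]
  refine Finset.sum_congr rfl fun j _ => ?_
  congr 1
  · exact Equiv.sum_comp σ (fun l => C (a j l * ((d l : ℝ) - d l₀)) * X ^ (d l))
  · refine Finset.prod_congr rfl fun i _ => ?_
    exact Equiv.sum_comp σ (fun l => C (a i l) * X ^ (d l))

/-- **Reversal identity** `x ↦ 1/x`: with `D ≥ d l` for all `l`, the Euler numerator of the reversed support `D − d` evaluates as
`E_{D−d}(t) = −t^{mD} · E_d(1/t)` (`t ≠ 0`). [folklore] -/
theorem eval_eulerNumerator_reverse {m K : ℕ} (d : Fin K → ℕ) (D : ℕ) (hD : ∀ l, d l ≤ D) (a : Fin m → Fin K → ℝ)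
    (l₀ : Fin K) {t : ℝ} (ht : t ≠ 0) :
    eval t (∑ j, (∑ l, C (a j l * (((D - d l : ℕ) : ℝ) - ((D - d l₀ : ℕ) : ℝ))) * X ^ (D - d l))
        * ∏ i ∈ Finset.univ.erase j, (∑ l, C (a i l) * X ^ (D - d l)) : ℝ[X])
      = -(t ^ (m * D)) * eval t⁻¹ (∑ j, (∑ l, C (a j l * ((d l : ℝ) - d l₀)) * X ^ (d l))
        * ∏ i ∈ Finset.univ.erase j, (∑ l, C (a i l) * X ^ (d l)) : ℝ[X]) := by
  classical
  rw [eval_eulerNumerator, eval_eulerNumerator, Finset.mul_sum]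
  rcases Nat.eq_zero_or_pos m with hm | hm
  · subst hm; simp
  refine Finset.sum_congr rfl fun j _ => ?_
  have hpow : ∀ n : ℕ, n ≤ D → t ^ (D - n) = t ^ D * t⁻¹ ^ n := by
    intro n hn
    rw [inv_pow, ← div_eq_mul_inv, eq_div_iff (pow_ne_zero _ ht), ← pow_add, Nat.sub_add_cancel hn]
  have hcast : ∀ l, (((D - d l : ℕ) : ℝ) - ((D - d l₀ : ℕ) : ℝ)) = -((d l : ℝ) - d l₀) := by
    intro l
    rw [Nat.cast_sub (hD l), Nat.cast_sub (hD l₀)]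
    ring
  -- letter: `Σ_l a (−(d_l − d_{l₀})) t^{D − d_l} = −t^D · B_j(1/t)`
  have hB : (∑ l, a j l * (((D - d l : ℕ) : ℝ) - ((D - d l₀ : ℕ) : ℝ)) * t ^ (D - d l))
      = -(t ^ D) * ∑ l, a j l * ((d l : ℝ) - d l₀) * t⁻¹ ^ (d l) := by
    rw [Finset.mul_sum]
    refine Finset.sum_congr rfl fun l _ => ?_
    rw [hcast l, hpow (d l) (hD l)]
    ring
  -- cofactor: `∏_{i≠j} f_i^{rev}(t) = t^{(m−1)D} ∏_{i≠j} f_i(1/t)`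
  have hF : ∀ i, (∑ l, a i l * t ^ (D - d l)) = t ^ D * ∑ l, a i l * t⁻¹ ^ (d l) := by
    intro i
    rw [Finset.mul_sum]
    refine Finset.sum_congr rfl fun l _ => ?_
    rw [hpow (d l) (hD l)]
    ring
  rw [hB, Finset.prod_congr rfl (fun i _ => hF i), Finset.prod_mul_distrib, Finset.prod_const,
    Finset.card_erase_of_mem (Finset.mem_univ j), Finset.card_univ, Fintype.card_fin]
  have hmD : t ^ (m * D) = t ^ D * (t ^ D) ^ (m - 1) := by
    rw [← pow_succ', Nat.sub_add_cancel hm, pow_mul']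
  rw [hmD]
  ring

/-- **Reversal does not change the number of positive zeros of the Euler numerator** (one inequality; the other is the same with
`d ↦ D − d`). [folklore] -/
theorem card_pos_roots_euler_le_reverse {m K : ℕ} (d : Fin K → ℕ) (D : ℕ) (hD : ∀ l, d l ≤ D) (a : Fin m → Fin K → ℝ)
    (l₀ : Fin K) :
    ((∑ j, (∑ l, C (a j l * ((d l : ℝ) - d l₀)) * X ^ (d l)) * ∏ i ∈ Finset.univ.erase j, (∑ l, C (a i l) * X ^ (d l))
        : ℝ[X]).roots.toFinset.filter (fun t => 0 < t)).card
      ≤ ((∑ j, (∑ l, C (a j l * (((D - d l : ℕ) : ℝ) - ((D - d l₀ : ℕ) : ℝ))) * X ^ (D - d l))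
        * ∏ i ∈ Finset.univ.erase j, (∑ l, C (a i l) * X ^ (D - d l)) : ℝ[X]).roots.toFinset.filter (fun t => 0 < t)).card := by
  classical
  set E : ℝ[X] := ∑ j, (∑ l, C (a j l * ((d l : ℝ) - d l₀)) * X ^ (d l)) * ∏ i ∈ Finset.univ.erase j, (∑ l, C (a i l) * X ^ (d l))
    with hE
  set E' : ℝ[X] := ∑ j, (∑ l, C (a j l * (((D - d l : ℕ) : ℝ) - ((D - d l₀ : ℕ) : ℝ))) * X ^ (D - d l))
        * ∏ i ∈ Finset.univ.erase j, (∑ l, C (a i l) * X ^ (D - d l)) with hE'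
  have hrev : ∀ t : ℝ, t ≠ 0 → eval t E' = -(t ^ (m * D)) * eval t⁻¹ E := fun t ht =>
    eval_eulerNumerator_reverse d D hD a l₀ ht
  by_cases hE0 : E' = 0
  · -- then `E` vanishes on `(0,∞)`, hence `E = 0`
    have hE00 : E = 0 := by
      apply Polynomial.eq_zero_of_infinite_isRoot
      apply Set.infinite_of_injective_forall_mem (f := fun n : ℕ => ((n : ℝ) + 1)⁻¹)
      · intro x y hxy
        have := inv_injective hxy
        exact_mod_cast (add_left_injective 1 this : (x : ℝ) = y)
      · intro n
        have hpos : (0 : ℝ) < n + 1 := by positivity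
        show IsRoot _ _
        have h := hrev ((n : ℝ) + 1) hpos.ne'
        rw [hE0, eval_zero] at h
        have htD : ((n : ℝ) + 1) ^ (m * D) ≠ 0 := pow_ne_zero _ hpos.ne'
        rw [IsRoot.def]
        rcases mul_eq_zero.1 h.symm with h1 | h1
        · exact absurd (neg_eq_zero.1 h1) htD
        · exact h1
    rw [hE00, hE0]
  refine Finset.card_le_card_of_injOn (fun t => t⁻¹) (fun t ht => ?_) (fun x _ y _ hxy => inv_injective hxy)
  rw [mem_coe, mem_filter, Multiset.mem_toFinset] at ht
  have ht0 : 0 < t := ht.2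
  have hEne : E ≠ 0 := by
    intro h
    rw [h, roots_zero] at ht
    exact Multiset.notMem_zero _ ht.1
  have hroot := (mem_roots hEne).mp ht.1
  rw [IsRoot.def] at hroot
  rw [mem_coe, mem_filter, Multiset.mem_toFinset, mem_roots hE0, IsRoot.def, hrev t⁻¹ (inv_ne_zero ht0.ne'), inv_inv, hroot,
    mul_zero]
  exact ⟨rfl, inv_pos.mpr ht0⟩

/-! ### §2 Top couplings by reversal -/

/-- The reversed-and-reindexed data: support `(0, d 2 − d 1, d 2 − d 0)`, coefficients `(a_{j2}, a_{j1}, a_{j0})`; the reversed Euler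
numerator at `l₀ = 2` IS the Euler numerator of these data at `l₀ = 0`. [folklore] -/
theorem eulerNumerator_reverse_top {m : ℕ} (d : Fin 3 → ℕ) (a : Fin m → Fin 3 → ℝ) :
    (∑ j, (∑ l, C (a j l * (((d 2 - d l : ℕ) : ℝ) - ((d 2 - d 2 : ℕ) : ℝ))) * X ^ (d 2 - d l))
        * ∏ i ∈ Finset.univ.erase j, (∑ l, C (a i l) * X ^ (d 2 - d l)) : ℝ[X])
      = ∑ j, (∑ l, C ((![a j 2, a j 1, a j 0] : Fin 3 → ℝ) l * (((![d 2 - d 2, d 2 - d 1, d 2 - d 0] : Fin 3 → ℕ) l : ℝ)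
            - ((![d 2 - d 2, d 2 - d 1, d 2 - d 0] : Fin 3 → ℕ) 0 : ℝ))) * X ^ ((![d 2 - d 2, d 2 - d 1, d 2 - d 0] : Fin 3 → ℕ) l))
        * ∏ i ∈ Finset.univ.erase j, (∑ l, C ((![a i 2, a i 1, a i 0] : Fin 3 → ℝ) l)
            * X ^ ((![d 2 - d 2, d 2 - d 1, d 2 - d 0] : Fin 3 → ℕ) l)) := by
  classical
  simp only [Fin.sum_univ_three, Matrix.cons_val_zero, Matrix.cons_val_one, Matrix.cons_val_two, Matrix.head_cons,
    Matrix.tail_cons]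
  refine Finset.sum_congr rfl fun j _ => ?_
  congr 1
  · ring
  · refine Finset.prod_congr rfl fun i _ => ?_
    ring

/-- ★ **THE TAME (NO-DIP) SECTOR AT THE TOP COUPLING** (`a_{j0}·a_{j2} < 0`, ratio `d 2 − d 0 ≤ 4 (d 2 − d 1)`, `l₀ = 2`):
`Z₊(eulerNumerator d a 2) ≤ 2m + 2` (reversal `x ↦ 1/x` + `eulerBound_tame` for the reversed data). [this file's theorem] -/
theorem eulerBound_tameTop {m : ℕ} (d : Fin 3 → ℕ) (h01 : d 0 < d 1) (h12 : d 1 < d 2) (h4 : d 2 - d 0 ≤ 4 * (d 2 - d 1))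
    (a : Fin m → Fin 3 → ℝ) (hac : ∀ j, a j 0 * a j 2 < 0) :
    ((∑ j, (∑ l, C (a j l * ((d l : ℝ) - d 2)) * X ^ (d l)) * ∏ i ∈ Finset.univ.erase j, (∑ l, C (a i l) * X ^ (d l))
      : ℝ[X]).roots.toFinset.filter (fun t => 0 < t)).card ≤ 2 * m + 2 := by
  classical
  have hD : ∀ l, d l ≤ d 2 := by
    intro l; fin_cases l
    · exact (h01.trans h12).le
    · exact h12.le
    · exact le_rfl
  refine (card_pos_roots_euler_le_reverse d (d 2) hD a 2).trans ?_
  rw [eulerNumerator_reverse_top d a]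
  refine eulerBound_tame _ ?_ ?_ ?_ _ (fun j => ?_)
  · show d 2 - d 2 < d 2 - d 1
    omega
  · show d 2 - d 1 < d 2 - d 0
    omega
  · show (d 2 - d 0) - (d 2 - d 2) ≤ 4 * ((d 2 - d 1) - (d 2 - d 2))
    omega
  · show a j 2 * a j 0 < 0
    rw [mul_comm]; exact hac j

/-- ★ **THE MIXED SECTOR AT THE TOP COUPLING** (factors no-dip or sharp dips; ratio `2 (d 2 − d 1) ≤ d 2 − d 0 ≤ 4 (d 2 − d 1)`, `l₀ = 2`):
`Z₊(eulerNumerator d a 2) ≤ 4m + 1` (reversal + `eulerBound_mixed` for the reversed data, witnesses `x₀ ↦ 1/x₀`). [this file's theorem] -/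
theorem eulerBound_mixedTop {m : ℕ} (d : Fin 3 → ℕ) (h01 : d 0 < d 1) (h12 : d 1 < d 2)
    (h2 : 2 * (d 2 - d 1) ≤ d 2 - d 0) (h4 : d 2 - d 0 ≤ 4 * (d 2 - d 1)) (a : Fin m → Fin 3 → ℝ)
    (hfac : ∀ j, a j 0 * a j 2 < 0 ∨
      (0 < a j 0 ∧ 0 < a j 2 ∧ ∃ x₀ : ℝ, 0 < x₀ ∧ a j 0 * x₀ ^ (d 0) + a j 1 * x₀ ^ (d 1) + a j 2 * x₀ ^ (d 2) < 0)) :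
    ((∑ j, (∑ l, C (a j l * ((d l : ℝ) - d 2)) * X ^ (d l)) * ∏ i ∈ Finset.univ.erase j, (∑ l, C (a i l) * X ^ (d l))
      : ℝ[X]).roots.toFinset.filter (fun t => 0 < t)).card ≤ 4 * m + 1 := by
  classical
  have hD : ∀ l, d l ≤ d 2 := by
    intro l; fin_cases l
    · exact (h01.trans h12).le
    · exact h12.le
    · exact le_rfl
  refine (card_pos_roots_euler_le_reverse d (d 2) hD a 2).trans ?_
  rw [eulerNumerator_reverse_top d a]
  refine eulerBound_mixed _ ?_ ?_ ?_ ?_ _ (fun j => ?_)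
  · show d 2 - d 2 < d 2 - d 1
    omega
  · show d 2 - d 1 < d 2 - d 0
    omega
  · show 2 * ((d 2 - d 1) - (d 2 - d 2)) ≤ (d 2 - d 0) - (d 2 - d 2)
    omega
  · show (d 2 - d 0) - (d 2 - d 2) ≤ 4 * ((d 2 - d 1) - (d 2 - d 2))
    omega
  · show a j 2 * a j 0 < 0 ∨ (0 < a j 2 ∧ 0 < a j 0 ∧
        ∃ x₀ : ℝ, 0 < x₀ ∧ a j 2 * x₀ ^ (d 2 - d 2) + a j 1 * x₀ ^ (d 2 - d 1) + a j 0 * x₀ ^ (d 2 - d 0) < 0)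
    rcases hfac j with h | ⟨ha, hc, y₀, hy₀, hneg⟩
    · left; rw [mul_comm]; exact h
    · refine Or.inr ⟨hc, ha, y₀⁻¹, inv_pos.mpr hy₀, ?_⟩
      have hpow : ∀ n : ℕ, n ≤ d 2 → y₀⁻¹ ^ (d 2 - n) = y₀⁻¹ ^ (d 2) * y₀ ^ n := by
        intro n hn
        rw [inv_pow, inv_pow, ← one_div, ← one_div, div_mul_eq_mul_div, one_mul,
          div_eq_div_iff (pow_ne_zero _ hy₀.ne') (pow_ne_zero _ hy₀.ne'), one_mul, ← pow_add, Nat.add_sub_cancel' hn]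
      have hval : a j 2 * y₀⁻¹ ^ (d 2 - d 2) + a j 1 * y₀⁻¹ ^ (d 2 - d 1) + a j 0 * y₀⁻¹ ^ (d 2 - d 0)
          = y₀⁻¹ ^ (d 2) * (a j 0 * y₀ ^ (d 0) + a j 1 * y₀ ^ (d 1) + a j 2 * y₀ ^ (d 2)) := by
        rw [hpow (d 2) le_rfl, hpow (d 1) h12.le, hpow (d 0) (h01.trans h12).le]
        ring
      rw [hval]
      exact mul_neg_of_pos_of_neg (pow_pos (inv_pos.mpr hy₀) _) hneg

end ProductPlusOne

end Summit.ValiantsHypothesis.ValiantsHypothesis.Theorems.LacunarySymmetroidMatrixDescartes
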